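import Summits.QuantumFields.BalabanUV.Beta.GAN24.DerivativeRateTransferJensenLadder

/-!
# `BalabanUV.Beta.GAN24.DerivativeRateTransferJensenMassFreeHub` — binder row G-an2-4 ∕ (CONV-C), route R6 «VALUES, NOT DERIVATIVES», PART 59:
# THE CLOSED-LOOP LETTER FROM CANONICAL STEPS — the loop defects of PART 57 ∕ 58 (`τ_xᵀτ_{x′}` for the open root-to-root transports `τ_x`) COMPOSE
# (`τ_xᵀτ_{x″} = (τ_xᵀτ_{x′})(τ_{x′}ᵀτ_{x″})`), so a HUB bound `|(τ_cᵀτ_x − 1)w| ≤ D_c|w|` gives the pairwise letter with `D = 2D_c`, and on the block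
# positions `Fin d → Fin L` a bound `D₁` for every CANONICAL COMB STEP `z → z + e_μ` (all later coordinates zero) gives `D_c ≤ (Σ_ν z_ν)·D₁ ≤ d(L−1)·D₁`
# by induction along the comb (unit b2b-balaban-gan24-p3, gen 44; v1)

NOT IN PRINT; OUR PROOF (for the ROUTE; [folklore] finite-dimensional linear algebra over `ℝ` — PART 25's defect algebra `defect_mul` ∕ `defect_transpose`
BY NAME, PART 27's ladder lemma `defect_ladder` BY NAME — and a double induction over the comb order of `Fin d → Fin L`).  HONEST FRAMING (cell contract, verbatim): «discharging `BetaPertH` makes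
Bałaban's UV stability UNCONDITIONAL — a real constructive-QFT result; it is NOT the continuum limit and NOT the Clay problem.»  HONEST DEPENDENCY
(verbatim): «continuum YM on T⁴ ⇐ BetaPertH ∧ nine spine estimates (0/9 proved); BetaPertH ⇐ (D1) ∧ (D4) ∧ CAP+tail; G-an2-4 gates asym, D1 and NE2/3/4.»

WHY THIS FILE.  PART 57 reduced the polar pair's `κ` to the defect `D` of the CLOSED lattice loops `τ_xᵀτ_{x′}` (root′ → σx′ → x′ → root → x → σx →
root′) and PART 58 produced the polar links from the same letter; what is left of LENS ITEM 12 (C) «`κ ≤ C·p̂`» is lattice Stokes for these loops.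
THIS FILE is the combinatorial half: (§1) the loops through a common root compose and invert inside the defect algebra of PART 25, so
**`loopDefect_of_hub`**: `|(τ_cᵀτ_x − 1)w| ≤ D_c|w|` for all `x` ⟹ `|(τ_xᵀτ_{x′} − 1)w| ≤ 2D_c|w|` for all `x, x′`; (§2) on block positions
`z : Fin d → Fin L` with hub `z = 0` (the block's root corner), if every CANONICAL COMB STEP — `z ↦ z + e_μ` with `z_ν = 0` for all `ν > μ`, the steps
of the taxi contour «first direction `0`, then `1`, …» — has loop defect `≤ D₁`, then **`hubDefect_comb`**: `|(τ_0ᵀτ_z − 1)w| ≤ (Σ_ν z_ν)·D₁·|w|`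
(induction on the number of directions in use, inner induction along the last one), hence **`loopDefect_comb`**: the pairwise letter with
`D = 2d(L−1)·D₁`.  PART 60 supplies `D₁ = L·p̂` on PART 24's encoding through §3's abstract rectangle (a canonical step's loop is a conjugated
transposed `1 × L` rectangle = a ladder of `L` plaquettes, PART 27 `defect_ladder`).

(§3) the abstract RECTANGLE: partial transports with a recursion are `List.ofFn` products, and for bottom ∕ top chain bonds `A_i ∕ B_i`, rungs `C_j`,
frames `W, W′` and `W_a = W·C_0`, `W_b = W′·C_ℓ` the loop `(W·T_ℓ·W′ᵀ)ᵀ·(W_a·T′_ℓ·W_bᵀ)` is `W′·T_ℓᵀ·Λᵀ·T_ℓ·W′ᵀ` with `Λ` PART 27's ladder, hence within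
`ℓ·p̂` when every plaquette `A_i·C_{i+1}·B_iᵀ·C_iᵀ` is within `p̂` (**`stepLoop_defect`**) — PART 60 instantiates it on PART 24's encoding.

WHAT THIS FILE PROVES (0 sorry, 0 `def`, nothing cited): §1 `loop_trans`, `loopDefect_trans`, `loopDefect_symm`, **`loopDefect_of_hub`**; §2 `sum_val_update`,
`hubDefect_comb_line`, **`hubDefect_comb`**, `sum_val_le`, **`loopDefect_comb`**; §3 `partialTransport_eq_prod`, `rectangle_conj`, `defect_trivialWord`,
**`stepLoop_defect`**.
WHAT IT DOES NOT DO: identify the lattice data (PART 60), bound plaquettes, instantiate anything of Bałaban's, or claim (CONS) ∕ exact (STAB).  SUPPLIER work on route R6 (rank 2, REDUCTION, no seat); no consumer of record; NEVER «G-an2-4 closed»; NOT (CONV-C), NOT D1, NOT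
`BetaPertH`, NOT continuum, NOT Clay.  Records: `HOME/b2b-balaban-gan24-p3/WOODBURY-FIBRE.md` v14.4. -/

noncomputable section

open Matrix Finset Function

namespace Summit.QuantumFields.BalabanUV.Beta.GAN24.DerivativeRateTransferJensenMassFreeHub

open Summit.QuantumFields.BalabanUV.Beta.GAN24.DerivativeRateTransferJensenChain
open Summit.QuantumFields.BalabanUV.Beta.GAN24.DerivativeRateTransferJensenHolonomy
open Summit.QuantumFields.BalabanUV.Beta.GAN24.DerivativeRateTransferJensenLadder

/-! ## §1 Loops through a common root compose: the hub bound gives the pairwise letter -/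

section Loops

variable {o : Type*} [Fintype o] [DecidableEq o]

/-- `τ₂` orthogonal ⟹ `τ₁ᵀτ₃ = (τ₁ᵀτ₂)(τ₂ᵀτ₃)`. [folklore] -/
theorem loop_trans (τ₁ τ₃ : Matrix o o ℝ) {τ₂ : Matrix o o ℝ} (h₂ : τ₂ᵀ * τ₂ = 1) : τ₁ᵀ * τ₃ = τ₁ᵀ * τ₂ * (τ₂ᵀ * τ₃) := by
  rw [Matrix.mul_assoc, ← Matrix.mul_assoc τ₂, mul_transpose_of_orthogonal h₂, Matrix.one_mul]

/-- **loop defects add along a chain**: `τ₁, τ₂` orthogonal, `|(τ₁ᵀτ₂ − 1)w| ≤ D₁|w|`, `|(τ₂ᵀτ₃ − 1)w| ≤ D₂|w|` (`D₁, D₂ ≥ 0`) ⟹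
`|(τ₁ᵀτ₃ − 1)w| ≤ (D₁ + D₂)|w|`. [folklore; PART 25 `defect_mul`] -/
theorem loopDefect_trans {τ₁ τ₂ τ₃ : Matrix o o ℝ} (h₁ : τ₁ᵀ * τ₁ = 1) (h₂ : τ₂ᵀ * τ₂ = 1) {D₁ D₂ : ℝ} (hD₁ : 0 ≤ D₁) (hD₂ : 0 ≤ D₂)
    (h12 : ∀ w : o → ℝ, ((τ₁ᵀ * τ₂ - 1) *ᵥ w) ⬝ᵥ ((τ₁ᵀ * τ₂ - 1) *ᵥ w) ≤ D₁ ^ 2 * (w ⬝ᵥ w))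
    (h23 : ∀ w : o → ℝ, ((τ₂ᵀ * τ₃ - 1) *ᵥ w) ⬝ᵥ ((τ₂ᵀ * τ₃ - 1) *ᵥ w) ≤ D₂ ^ 2 * (w ⬝ᵥ w)) :
    ∀ w : o → ℝ, ((τ₁ᵀ * τ₃ - 1) *ᵥ w) ⬝ᵥ ((τ₁ᵀ * τ₃ - 1) *ᵥ w) ≤ (D₁ + D₂) ^ 2 * (w ⬝ᵥ w) := by
  rw [loop_trans τ₁ τ₃ h₂]
  exact defect_mul (orthogonal_mul (transpose_orthogonal h₁) h₂) hD₁ hD₂ h12 h23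

/-- **loop defects are symmetric**: `τ₁, τ₂` orthogonal, `|(τ₁ᵀτ₂ − 1)w| ≤ D|w|` ⟹ `|(τ₂ᵀτ₁ − 1)w| ≤ D|w|`. [folklore; PART 25 `defect_transpose`] -/
theorem loopDefect_symm {τ₁ τ₂ : Matrix o o ℝ} (h₁ : τ₁ᵀ * τ₁ = 1) (h₂ : τ₂ᵀ * τ₂ = 1) {D : ℝ}
    (h12 : ∀ w : o → ℝ, ((τ₁ᵀ * τ₂ - 1) *ᵥ w) ⬝ᵥ ((τ₁ᵀ * τ₂ - 1) *ᵥ w) ≤ D ^ 2 * (w ⬝ᵥ w)) :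
    ∀ w : o → ℝ, ((τ₂ᵀ * τ₁ - 1) *ᵥ w) ⬝ᵥ ((τ₂ᵀ * τ₁ - 1) *ᵥ w) ≤ D ^ 2 * (w ⬝ᵥ w) := by
  have e : τ₂ᵀ * τ₁ = (τ₁ᵀ * τ₂)ᵀ := by rw [transpose_mul, transpose_transpose]
  rw [e]
  exact defect_transpose (orthogonal_mul (transpose_orthogonal h₁) h₂) h12

/-- **`loopDefect_of_hub` — THE PAIRWISE LETTER FROM A HUB** [our proof]: orthogonal `τ_x`, a hub `c` with `|(τ_cᵀτ_x − 1)w| ≤ D_c|w|` for all `x`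
(`D_c ≥ 0`) ⟹ `|(τ_xᵀτ_{x′} − 1)w| ≤ 2D_c|w|` for all `x, x′`. -/
theorem loopDefect_of_hub {ν : Type*} {τ : ν → Matrix o o ℝ} (hτ : ∀ x, (τ x)ᵀ * τ x = 1) (c : ν) {Dc : ℝ} (hDc : 0 ≤ Dc)
    (hhub : ∀ x (w : o → ℝ), (((τ c)ᵀ * τ x - 1) *ᵥ w) ⬝ᵥ (((τ c)ᵀ * τ x - 1) *ᵥ w) ≤ Dc ^ 2 * (w ⬝ᵥ w)) (x x' : ν) :
    ∀ w : o → ℝ, (((τ x)ᵀ * τ x' - 1) *ᵥ w) ⬝ᵥ (((τ x)ᵀ * τ x' - 1) *ᵥ w) ≤ (2 * Dc) ^ 2 * (w ⬝ᵥ w) := by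
  rw [two_mul]
  exact loopDefect_trans (hτ x) (hτ c) hDc hDc (loopDefect_symm (hτ c) (hτ x) (hhub x)) (hhub x')

end Loops

/-! ## §2 The hub bound along the comb of `Fin d → Fin L` -/

section Comb

variable {o : Type*} [Fintype o] [DecidableEq o] {d L : ℕ}

omit [Fintype o] [DecidableEq o] in
/-- coordinate sums under an update: `Σ_ν (update z μ a)_ν + z_μ = Σ_ν z_ν + a`. [folklore] -/
theorem sum_val_update (z : Fin d → Fin L) (μ : Fin d) (a : Fin L) :
    (∑ ν, ((update z μ a ν : Fin L) : ℕ)) + (z μ : ℕ) = (∑ ν, (z ν : ℕ)) + (a : ℕ) := by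
  rw [← Finset.add_sum_erase Finset.univ _ (Finset.mem_univ μ), ← Finset.add_sum_erase Finset.univ (fun ν => (z ν : ℕ)) (Finset.mem_univ μ),
    update_self]
  have h : ∑ ν ∈ Finset.univ.erase μ, ((update z μ a ν : Fin L) : ℕ) = ∑ ν ∈ Finset.univ.erase μ, (z ν : ℕ) :=
    Finset.sum_congr rfl fun ν hν => by rw [update_of_ne (Finset.ne_of_mem_erase hν)]
  rw [h]; ring

/-- **the inner induction, along one direction**: hub bound `B₀` at `z0` with `z0_μ = 0` and `z0_ν = 0` for `ν > μ`, canonical steps within `D₁` ⟹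
hub bound `B₀ + j·D₁` at `update z0 μ j`. [our proof] -/
theorem hubDefect_comb_line {τ : (Fin d → Fin L) → Matrix o o ℝ} (hτ : ∀ z, (τ z)ᵀ * τ z = 1) {D₁ : ℝ} (hD₁ : 0 ≤ D₁)
    (hstep : ∀ (z : Fin d → Fin L) (μ : Fin d) (h : (z μ : ℕ) + 1 < L), (∀ ν, μ < ν → (z ν : ℕ) = 0) → ∀ w : o → ℝ,
      (((τ z)ᵀ * τ (update z μ ⟨(z μ : ℕ) + 1, h⟩) - 1) *ᵥ w) ⬝ᵥ (((τ z)ᵀ * τ (update z μ ⟨(z μ : ℕ) + 1, h⟩) - 1) *ᵥ w) ≤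
        D₁ ^ 2 * (w ⬝ᵥ w))
    (c z0 : Fin d → Fin L) (μ : Fin d) (hz0μ : (z0 μ : ℕ) = 0) (hz0 : ∀ ν, μ < ν → (z0 ν : ℕ) = 0) {B₀ : ℝ} (hB₀ : 0 ≤ B₀)
    (hc : ∀ w : o → ℝ, (((τ c)ᵀ * τ z0 - 1) *ᵥ w) ⬝ᵥ (((τ c)ᵀ * τ z0 - 1) *ᵥ w) ≤ B₀ ^ 2 * (w ⬝ᵥ w)) :
    ∀ (j : ℕ) (hj : j < L) (w : o → ℝ),
      (((τ c)ᵀ * τ (update z0 μ ⟨j, hj⟩) - 1) *ᵥ w) ⬝ᵥ (((τ c)ᵀ * τ (update z0 μ ⟨j, hj⟩) - 1) *ᵥ w) ≤ (B₀ + j * D₁) ^ 2 * (w ⬝ᵥ w) := by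
  intro j
  induction j with
  | zero =>
    intro hj w
    have e : update z0 μ (⟨0, hj⟩ : Fin L) = z0 := by
      rw [update_eq_self_iff]; exact Fin.ext hz0μ.symm
    rw [e, Nat.cast_zero, zero_mul, add_zero]
    exact hc w
  | succ j ih =>
    intro hj w
    have hj' : j < L := Nat.lt_of_succ_lt hj
    -- the canonical step from `update z0 μ j` in direction `μ`
    have hlater : ∀ ν, μ < ν → ((update z0 μ (⟨j, hj'⟩ : Fin L) ν : Fin L) : ℕ) = 0 := fun ν hν => by
      rw [update_of_ne (ne_of_gt hν)]; exact hz0 ν hν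
    have hval : ((update z0 μ (⟨j, hj'⟩ : Fin L) μ : Fin L) : ℕ) + 1 < L := by rw [update_self]; exact hj
    have hs := hstep (update z0 μ ⟨j, hj'⟩) μ hval hlater
    have e : update (update z0 μ (⟨j, hj'⟩ : Fin L)) μ ⟨((update z0 μ (⟨j, hj'⟩ : Fin L) μ : Fin L) : ℕ) + 1, hval⟩ =
        update z0 μ (⟨j + 1, hj⟩ : Fin L) := by
      rw [update_idem]
      congr 1
      exact Fin.ext (by simp only [update_self])
    rw [e] at hs
    have h := loopDefect_trans (hτ c) (hτ _) (by positivity) hD₁ (ih hj') hs w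
    refine h.trans (le_of_eq ?_)
    push_cast; ring

/-- **`hubDefect_comb` — THE HUB BOUND ALONG THE COMB** [our proof]: orthogonal `τ_z` on the block positions `z : Fin d → Fin L` (`L > 0`), every
canonical comb step (`z ↦ z + e_μ`, all coordinates after `μ` zero) with loop defect `≤ D₁` (`D₁ ≥ 0`) ⟹ with the root corner `0`:
`|(τ_0ᵀτ_z − 1)w|² ≤ ((Σ_ν z_ν)·D₁)²|w|²` for every `z`. -/
theorem hubDefect_comb (hL : 0 < L) {τ : (Fin d → Fin L) → Matrix o o ℝ} (hτ : ∀ z, (τ z)ᵀ * τ z = 1) {D₁ : ℝ} (hD₁ : 0 ≤ D₁)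
    (hstep : ∀ (z : Fin d → Fin L) (μ : Fin d) (h : (z μ : ℕ) + 1 < L), (∀ ν, μ < ν → (z ν : ℕ) = 0) → ∀ w : o → ℝ,
      (((τ z)ᵀ * τ (update z μ ⟨(z μ : ℕ) + 1, h⟩) - 1) *ᵥ w) ⬝ᵥ (((τ z)ᵀ * τ (update z μ ⟨(z μ : ℕ) + 1, h⟩) - 1) *ᵥ w) ≤
        D₁ ^ 2 * (w ⬝ᵥ w))
    (z : Fin d → Fin L) (w : o → ℝ) :
    (((τ fun _ => ⟨0, hL⟩)ᵀ * τ z - 1) *ᵥ w) ⬝ᵥ (((τ fun _ => ⟨0, hL⟩)ᵀ * τ z - 1) *ᵥ w) ≤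
      ((∑ ν, (z ν : ℕ) : ℕ) * D₁) ^ 2 * (w ⬝ᵥ w) := by
  -- outer induction on the number `k` of directions in use
  suffices H : ∀ k : ℕ, k ≤ d → ∀ z : Fin d → Fin L, (∀ ν : Fin d, k ≤ (ν : ℕ) → (z ν : ℕ) = 0) → ∀ w : o → ℝ,
      (((τ fun _ => ⟨0, hL⟩)ᵀ * τ z - 1) *ᵥ w) ⬝ᵥ (((τ fun _ => ⟨0, hL⟩)ᵀ * τ z - 1) *ᵥ w) ≤
        ((∑ ν, (z ν : ℕ) : ℕ) * D₁) ^ 2 * (w ⬝ᵥ w) from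
    H d le_rfl z (fun ν hν => absurd ν.isLt (not_lt.mpr hν)) w
  intro k
  induction k with
  | zero =>
    intro _ z hz w
    have e : z = fun _ => ⟨0, hL⟩ := funext fun ν => Fin.ext (hz ν (Nat.zero_le _))
    subst e
    rw [hτ]
    simp
  | succ k ih =>
    intro hk z hz w
    have hkd : k < d := Nat.lt_of_succ_le hk
    set μ : Fin d := ⟨k, hkd⟩ with hμ
    -- zero the `k`-th coordinate and apply the induction hypothesis
    set z0 : Fin d → Fin L := update z μ ⟨0, hL⟩ with hz0def
    have hz0 : ∀ ν : Fin d, k ≤ (ν : ℕ) → (z0 ν : ℕ) = 0 := fun ν hν => by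
      by_cases hνμ : ν = μ
      · rw [hνμ, hz0def, update_self]
      · rw [hz0def, update_of_ne hνμ]
        refine hz ν (Nat.succ_le_of_lt (lt_of_le_of_ne hν fun h => hνμ (Fin.ext ?_)))
        rw [hμ]; exact h.symm
    have hB₀ := ih hkd.le z0 hz0
    -- walk along direction `μ` from `z0` to `z`
    have hz0μ : (z0 μ : ℕ) = 0 := by rw [hz0def, update_self]
    have hz0later : ∀ ν, μ < ν → (z0 ν : ℕ) = 0 := fun ν hν => hz0 ν (Nat.le_of_lt (Fin.lt_def.mp hν))
    have hline := hubDefect_comb_line hτ hD₁ hstep (fun _ => ⟨0, hL⟩) z0 μ hz0μ hz0later (by positivity) hB₀ (z μ : ℕ) (z μ).isLt w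
    have e : update z0 μ (⟨(z μ : ℕ), (z μ).isLt⟩ : Fin L) = z := by
      rw [hz0def, update_idem, update_eq_self_iff]
    rw [e] at hline
    refine hline.trans (le_of_eq ?_)
    have hsum : ((∑ ν, (z0 ν : ℕ) : ℕ) : ℝ) + (z μ : ℕ) = ((∑ ν, (z ν : ℕ) : ℕ) : ℝ) := by
      have h := sum_val_update z μ (⟨0, hL⟩ : Fin L)
      rw [← hz0def] at h
      simp only [add_zero] at h
      exact_mod_cast h
    rw [← hsum]; ring

omit [Fintype o] [DecidableEq o] in
/-- `Σ_ν z_ν ≤ d·(L − 1)` on `Fin d → Fin L`. [folklore] -/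
theorem sum_val_le (z : Fin d → Fin L) : ((∑ ν, (z ν : ℕ) : ℕ) : ℝ) ≤ d * ((L : ℝ) - 1) := by
  have h : ∀ ν, ((z ν : ℕ) : ℝ) ≤ (L : ℝ) - 1 := fun ν => by
    have := (z ν).isLt
    have h' : ((z ν : ℕ) : ℝ) + 1 ≤ L := by exact_mod_cast this
    linarith
  calc ((∑ ν, (z ν : ℕ) : ℕ) : ℝ) = ∑ ν, ((z ν : ℕ) : ℝ) := by push_cast; rfl
    _ ≤ ∑ _ν : Fin d, ((L : ℝ) - 1) := Finset.sum_le_sum fun ν _ => h ν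
    _ = d * ((L : ℝ) - 1) := by rw [Finset.sum_const, Finset.card_univ, Fintype.card_fin, nsmul_eq_mul]

/-- **`loopDefect_comb` — THE CLOSED-LOOP LETTER FROM CANONICAL STEPS** [our proof]: orthogonal `τ_z` on `Fin d → Fin L` (`L > 0`), canonical comb
steps within `D₁ ≥ 0` ⟹ `|(τ_zᵀτ_{z′} − 1)w|² ≤ (2d(L−1)·D₁)²|w|²` for all `z, z′`. -/
theorem loopDefect_comb (hL : 0 < L) {τ : (Fin d → Fin L) → Matrix o o ℝ} (hτ : ∀ z, (τ z)ᵀ * τ z = 1) {D₁ : ℝ} (hD₁ : 0 ≤ D₁)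
    (hstep : ∀ (z : Fin d → Fin L) (μ : Fin d) (h : (z μ : ℕ) + 1 < L), (∀ ν, μ < ν → (z ν : ℕ) = 0) → ∀ w : o → ℝ,
      (((τ z)ᵀ * τ (update z μ ⟨(z μ : ℕ) + 1, h⟩) - 1) *ᵥ w) ⬝ᵥ (((τ z)ᵀ * τ (update z μ ⟨(z μ : ℕ) + 1, h⟩) - 1) *ᵥ w) ≤
        D₁ ^ 2 * (w ⬝ᵥ w))
    (z z' : Fin d → Fin L) (w : o → ℝ) :
    (((τ z)ᵀ * τ z' - 1) *ᵥ w) ⬝ᵥ (((τ z)ᵀ * τ z' - 1) *ᵥ w) ≤ (2 * (d * ((L : ℝ) - 1)) * D₁) ^ 2 * (w ⬝ᵥ w) := by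
  have hDc : 0 ≤ d * ((L : ℝ) - 1) * D₁ := by
    have hL1 : (1 : ℝ) ≤ L := by exact_mod_cast hL
    have : 0 ≤ (L : ℝ) - 1 := by linarith
    positivity
  have hhub : ∀ (x : Fin d → Fin L) (w : o → ℝ),
      (((τ fun _ => ⟨0, hL⟩)ᵀ * τ x - 1) *ᵥ w) ⬝ᵥ (((τ fun _ => ⟨0, hL⟩)ᵀ * τ x - 1) *ᵥ w) ≤ (d * ((L : ℝ) - 1) * D₁) ^ 2 * (w ⬝ᵥ w) :=
    fun x => defect_mono (V := (τ fun _ => ⟨0, hL⟩)ᵀ * τ x) (by positivity)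
      (mul_le_mul_of_nonneg_right (sum_val_le x) hD₁) (fun w => by
        have h := hubDefect_comb hL hτ hD₁ hstep x w
        exact h)
  have h := loopDefect_of_hub hτ (fun _ => ⟨0, hL⟩) hDc hhub z z' w
  refine h.trans (le_of_eq ?_)
  ring

end Comb

/-! ## §3 The rectangle in letters: a canonical step's loop is a conjugated transposed ladder -/

section Rectangle

variable {o : Type*} [Fintype o] [DecidableEq o]

/-- **PARTIAL TRANSPORTS ARE PRODUCTS**: `T 0 = 1`, `T (i+1) = T i·R_i` (`i < ℓ`) ⟹ `T n = Π_{i<n} R_i` (`List.ofFn`) for `n ≤ ℓ`. [folklore] -/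
theorem partialTransport_eq_prod {ℓ : ℕ} {Rb : ℕ → Matrix o o ℝ} {T : ℕ → Matrix o o ℝ}
    (hT0 : T 0 = 1) (hT : ∀ i, i < ℓ → T (i + 1) = T i * Rb i) :
    ∀ n, n ≤ ℓ → T n = (List.ofFn fun i : Fin n => Rb i).prod := by
  intro n
  induction n with
  | zero => intro _; rw [List.ofFn_zero, List.prod_nil, hT0]
  | succ n ih =>
    intro hn
    rw [hT n (Nat.lt_of_succ_le hn), ih (Nat.le_of_succ_le hn), List.ofFn_succ', List.prod_concat]
    rfl

/-- **`rectangle_conj`** — the loop of a canonical step in letters: with `τ = W·T·W′ᵀ`, `τ⁺ = (W·R_a)·T⁺·(W′·R_b)ᵀ` (`W, T` orthogonal),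
`τᵀτ⁺ = W′·(Tᵀ·(T·R_b·T⁺ᵀ·R_aᵀ)ᵀ·T)·W′ᵀ`. [folklore] -/
theorem rectangle_conj {W W' T T' Ra Rb : Matrix o o ℝ} (hW : Wᵀ * W = 1) (hT : Tᵀ * T = 1) :
    (W * T * W'ᵀ)ᵀ * (W * Ra * T' * (W' * Rb)ᵀ) = W' * (Tᵀ * (T * Rb * T'ᵀ * Raᵀ)ᵀ * (Tᵀ)ᵀ) * W'ᵀ := by
  rw [transpose_mul, transpose_mul, transpose_transpose, transpose_mul, transpose_mul, transpose_mul, transpose_mul, transpose_transpose,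
    transpose_transpose, transpose_transpose]
  -- both sides: `W′ Tᵀ Wᵀ W Ra T′ Rbᵀ W′ᵀ` vs `W′ Tᵀ Ra T′ Rbᵀ Tᵀ T W′ᵀ`
  simp only [Matrix.mul_assoc]
  rw [orthogonal_cancel hW, orthogonal_cancel hT]

/-- the degenerate plaquette `A·B·Bᵀ·Aᵀ = 1` (`A, B` orthogonal) is within any `p̂`. [folklore] -/
theorem defect_trivialWord {A B : Matrix o o ℝ} (hA : Aᵀ * A = 1) (hB : Bᵀ * B = 1) (phat : ℝ) (w : o → ℝ) :
    ((A * B * Bᵀ * Aᵀ - 1) *ᵥ w) ⬝ᵥ ((A * B * Bᵀ * Aᵀ - 1) *ᵥ w) ≤ phat ^ 2 * (w ⬝ᵥ w) := by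
  have e : A * B * Bᵀ * Aᵀ = 1 := by
    rw [Matrix.mul_assoc A, mul_transpose_of_orthogonal hB, Matrix.mul_one, mul_transpose_of_orthogonal hA]
  rw [e, sub_self, Matrix.zero_mulVec, dotProduct_zero]
  exact mul_nonneg (sq_nonneg _) (dotProduct_self_nonneg' w)

/-- **`stepLoop_defect` — THE RECTANGLE IN LETTERS** [our proof]: bottom bonds `A_i`, top bonds `B_i`, rungs `C_j` (all orthogonal), partial transports
`T` (along `A`) and `T′` (along `B`) with their recursions, every plaquette `A_i·C_{i+1}·B_iᵀ·C_iᵀ` (`i < ℓ`) within `p̂ ≥ 0`, frames `W, W′` orthogonal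
and `W_a = W·C_0`, `W_b = W′·C_ℓ` ⟹ the loop `(W·T_ℓ·W′ᵀ)ᵀ·(W_a·T′_ℓ·W_bᵀ)` is within `ℓ·p̂` (it is `W′·T_ℓᵀ·Λᵀ·T_ℓ·W′ᵀ` with `Λ` PART 27's
ladder). -/
theorem stepLoop_defect {ℓ : ℕ} {A B C : ℕ → Matrix o o ℝ} (hA : ∀ i, (A i)ᵀ * A i = 1) (hB : ∀ i, (B i)ᵀ * B i = 1)
    (hC : ∀ j, (C j)ᵀ * C j = 1) {T T' : ℕ → Matrix o o ℝ} (hT0 : T 0 = 1) (hT : ∀ i, i < ℓ → T (i + 1) = T i * A i)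
    (hT'0 : T' 0 = 1) (hT' : ∀ i, i < ℓ → T' (i + 1) = T' i * B i) {W W' Wa Wb : Matrix o o ℝ} (hW : Wᵀ * W = 1) (hW' : W'ᵀ * W' = 1)
    (hWa : Wa = W * C 0) (hWb : Wb = W' * C ℓ) {phat : ℝ} (hphat : 0 ≤ phat)
    (hpl : ∀ i, i < ℓ → ∀ w : o → ℝ,
      ((A i * C (i + 1) * (B i)ᵀ * (C i)ᵀ - 1) *ᵥ w) ⬝ᵥ ((A i * C (i + 1) * (B i)ᵀ * (C i)ᵀ - 1) *ᵥ w) ≤ phat ^ 2 * (w ⬝ᵥ w)) (w : o → ℝ) :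
    (((W * T ℓ * W'ᵀ)ᵀ * (Wa * T' ℓ * Wbᵀ) - 1) *ᵥ w) ⬝ᵥ (((W * T ℓ * W'ᵀ)ᵀ * (Wa * T' ℓ * Wbᵀ) - 1) *ᵥ w) ≤ (ℓ * phat) ^ 2 * (w ⬝ᵥ w) := by
  subst hWa hWb
  have hTp : T ℓ = (List.ofFn fun i : Fin ℓ => A i).prod := partialTransport_eq_prod hT0 hT ℓ le_rfl
  have hT'p : T' ℓ = (List.ofFn fun i : Fin ℓ => B i).prod := partialTransport_eq_prod hT'0 hT' ℓ le_rfl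
  have hΛ := defect_ladder ℓ (fun i : Fin ℓ => A i) (fun i : Fin ℓ => B i) (fun j : Fin (ℓ + 1) => C j) phat hphat (fun i => hA i)
    (fun i => hB i) (fun j => hC j) (fun i w' => by simpa only [Fin.val_succ, Fin.val_castSucc] using hpl i i.isLt w')
  have hΛo := orthogonal_ladder (fun i : Fin ℓ => A i) (fun i : Fin ℓ => B i) (fun j : Fin (ℓ + 1) => C j) (fun i => hA i) (fun i => hB i)
    (fun j => hC j)
  simp only [Fin.val_last, Fin.val_zero] at hΛ hΛo
  have hTo : (T ℓ)ᵀ * T ℓ = 1 := by rw [hTp]; exact orthogonal_prod_ofFn _ fun i => hA i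
  rw [rectangle_conj hW hTo]
  have h := defect_conj hW' (defect_conj (transpose_orthogonal hTo) (defect_transpose hΛo hΛ)) w
  rw [← hTp, ← hT'p] at h
  exact h

end Rectangle

end Summit.QuantumFields.BalabanUV.Beta.GAN24.DerivativeRateTransferJensenMassFreeHub

end
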